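import Summits.QuantumFields.YangMills.Theorems.BalabanUVNodesN12DirectSurjHsurjProxiesPrelim
import Literature.MathematicalPhysics.QuantumFieldTheory.Balaban1983to89.Node00.MultiScaleFibreChartB
import Literature.MathematicalPhysics.QuantumFieldTheory.Balaban1983to89.Node00.MultiScaleFibreChartLagrangeB
import Summits.QuantumFields.YangMills.Theorems.BalabanUVNodesN12NearFlatDelta2LetterComponentB
import Summits.QuantumFields.YangMills.Theorems.BalabanUVNodesN12DirectSurjSharpDelta2B
import HarnessLib

/-!
# BalabanUVNodes ∕ N12 — (P4)′ WITHOUT THE GLOBAL GUARD, PRELIMINARIES: component transfer to guarded PROXIES and the footprint lemmas from differentiability alone — **BOND-DATUM EDITION** (`…N12DirectSurjHsurjProxiesPrelimB`, USED DECLARATIONS ONLY)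

The print-datum ([Balaban1984PropagatorsII] (2.3)) (γ) twin of `Summits/…/Theorems/BalabanUVNodesN12DirectSurjHsurjProxiesPrelim.lean`: the declarations of the parent whose STATEMENT reads the determining datum
(`differentiableAt_msChart_of_towerProxies`, `fderiv_msChart_apply_eq_of_sharpProxy`, `fderiv_msChart_apply_eq_zero_of_siteSupport'`, `fderiv_msChart_apply_eq_zero_of_vanish_sharp'`) and which N12's junction of record v14ᴸ uses (dag-n12-c g35 probe-2 census `UsedConstsN12RoadTyped2`, THEOREMS block), re-typed over a
BOND-LEVEL datum `𝔅 : BDetSet` (F0a `B15DeterminingSetsB`) and dag-n12-c's bond-datum chart `Node00.msChartB` (✓p774329; `msChart 𝐁 = msChartB (bondsDet 𝐁)` by `rfl`).  GENERATOR twin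
(this seat's `work/g32/gen_thm.py`, block-extracted from the parent's tree bytes): namespace `…N12DirectSurjHsurjProxiesPrelimB`, SAME short names, `DetSet ↦ BDetSet`, `AgreeOn 𝐁 ↦ AgreeOnB 𝔅`,
`IsMinimizer ↦ IsMinimizerB`, `bondsOf (𝐁 j) ↦ 𝔅 j`, `msChart ∕ constrCard ∕ constrEnum ∕ ConstrSet ↦ …B`, NODE 00 chart lemmas `…msChart… ↦ …msChartB…`; proofs VERBATIM; the parent's
datum-free declarations REUSED BY NAME (`open`), never copied (private plumbing excepted, №366 R2).  The parent's (b) statements are the instances `𝔅 := bondsDet 𝐁`.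

Cell `pub-ymgap` (HUMAN RULINGS D-0062 ∕ D-0149), seat `pub-ymgap-dag-n12-d` g32 (R134 N12 [B15] s2; the (ii) Theorems-side re-key of N12's road at print's [II] (2.3) datum — director-ym №338 ∕
№343 (E1)(iii-b), FLAG №16 ∕ ruling (α); dag-n12-c DESIGN memo a793b2ebc0b803bf (ii); `N12-ROAD-TWIN-ORDER-2026-08-30.md`).  Count-neutral helper of K1⁹ `stmt-QuantumFields-27364`,
`--kind proof --supports … --as helper`.  THEOREMS ONLY (0 `def`, 0 `instance`, 0 `sorry`).

HONEST FRAMING (director-ym №338 (5)).  PURELY ADDITIVE: the parent stays landed and true on its own text; nothing in it is edited; no displayed premise of any consumer is deleted or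
weakened; every hypothesis of the parent stays a hypothesis.  Nothing of Bałaban's analysis asserted; N12 NOT discharged; K0⁷ ∕ K1⁹ NOT closed; counts unmoved (typed 28∕28 · discharged
8∕27, A 8∕28; K 1∕4); one finite 𝕋⁴ programme at fixed ε — R4 closes the conditional rung `BalabanLadder.UV` only; NOT the Yang–Mills mass gap (Clay); nothing continuum ∕ ℝ⁴ ∕ OS.

PARENT's DOCSTRING (the mathematics and the citations; read the site-level `𝐁` as the bond datum `𝔅`):
# BalabanUVNodes ∕ N12 — (P4)′ WITHOUT THE GLOBAL GUARD, PRELIMINARIES: component transfer to guarded PROXIES and the footprint lemmas from differentiability alone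
# (LOCATED-HSB repair pen ρ5c-(P4)′, dag-n12-c g21's census D4′; the assembly is the sequel `…N12DirectSurjHsurjProxies`)

Cell `pub-ymgap` (HUMAN RULINGS D-0062 ∕ D-0149), WIDTH SEAT `pub-ymgap-dag-n12-w6` g7 (node N12 = [B15]; key K1⁹ `stmt-QuantumFields-27364`, `--kind proof --supports … --as helper`;
count-neutral).  THEOREMS ONLY (0 `def`, 0 `instance`, 0 `sorry`).

WHY.  g6's (P4)′ right inverse `N12DirectSurjHsurj.exists_rightInverse_letter` (p664681) asks the GLOBAL small-field guard `SmallBelow (avOfRecord F N K) k U₀` of the minimiser down the whole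
torus — not derivable from the (2.12) class (LOCATED-HSB).  Its proof reads the guard only through (i) the differentiability of the chart `Ψ_{𝐁,W,U₀}` at `0` and (ii) component-wise letters
((δ₂)♯, the row bound, the curved site block) that read `U₀` on the SHARP TOWER of their rows.  Both transfer to GUARDED PROXIES agreeing with `U₀` there (g6's own
`…SharpDelta2.msChart_apply_eq_of_eqOn_sharp_of_fibre`, dag-n12-w4's `…Delta2LetterComponent.msChart_apply_eq_of_eqOn_feeds_of_fibre`): `Ψ_{𝐁,W,U₀}(·)_i = Ψ_{𝐁,M˙U′,U′}(·)_i` as FUNCTIONS.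
THIS FILE: ★ `fderiv_apply_eq_of_component_eq` (equal components of two maps differentiable at `0` have equal derivative components), ★★ `differentiableAt_msChart_of_towerProxies`
(differentiability of `Ψ_{𝐁,W,U₀}` from ONE guarded proxy per constrained bond — dag-n12-c g21's `hprox` shape), ★★ `fderiv_msChart_apply_eq_of_sharpProxy` (the `i`-th derivative component
at `U₀` IS the one at a proxy agreeing on the sharp tower), and the two footprint lemmas of g6's `…Footprint` re-derived from DIFFERENTIABILITY instead of the guard: ★
`fderiv_msChart_apply_eq_zero_of_vanish_sharp'`, ★★ `fderiv_msChart_apply_eq_zero_of_siteSupport'`.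

HONEST FRAMING.  Kernel calculus ∕ bookkeeping over landed modules; the proxies are HYPOTHESES (dag-n12-c's ρ5b `…TowerProxiesOfClass` produces them from the class); nothing of Bałaban's
asserted; count-neutral; N12 NOT discharged; K1⁹ NOT closed; counts unmoved (typed 28∕28); one finite 𝕋⁴ programme at fixed `ε = L^{-K}` — R4 closes the conditional rung `BalabanLadder.UV`
only; no summit statement is proved here and NOT the Yang–Mills mass gap (Clay); nothing continuum ∕ ℝ⁴ ∕ OS.

References: [Balaban1987RG1] CMP 109 (1987), (0.4) p.253; [Balaban1988Convergent] CMP 119 (1988) 243–285, (2.2) p.255, (2.10)–(2.13) pp.256–257; [Balaban1985Variational] CMP 102 (1985)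
277–309, (47) p.285, (82)–(83) p.290.
-/

noncomputable section

open scoped BigOperators Matrix.Norms.L2Operator Topology NNReal
open Filter

namespace Summit.QuantumFields.YangMills.BalabanUVNodes.N12DirectSurjHsurjProxiesPrelimB

open Literature.MathematicalPhysics.QuantumFieldTheory.Balaban1983to89.B15DeterminingSetsB

open Literature.MathematicalPhysics.QuantumFieldTheory.Balaban1983to89
open T4Continuum (T4Family)
open T4AdjointCovarianceUnitary (lieSU)
open B15DeterminingSets
open B14.Eq213DetSet (Bj maxDomT Bj_of_gt)
open B14.Eq213MaximalDomains (side)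
open B14.Eq216Concrete (feeds)
open B5Eq118OneStroke (iterBlockOf)
open Node00
open T4ReflectionConeSharp (TwoBlockLocal twoBlockLocal_blockAvg)
open Summit.QuantumFields.YangMills.BalabanUVNodes.N12DirectSurjSharpDelta2 (iter_congr_of_twoBlockLocal)
open Summit.QuantumFields.YangMills.BalabanUVNodes.N12DirectSurjSharpDelta2B (msChart_apply_eq_of_eqOn_sharp_of_fibre)
open Summit.QuantumFields.YangMills.BalabanUVNodes.N12NearFlatDelta2LetterComponentB (msChart_apply_eq_of_eqOn_feeds_of_fibre)
open Summit.QuantumFields.YangMills.BalabanUVNodes.N12DirectSurjFootprint (iterBlockOf_embIter_iterBlockOf not_mem_bondsOf_Bj_of_centres)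
open T4AdjointCovarianceUnitary (expSU)
open Summit.QuantumFields.YangMills.BalabanUVNodes.N07CritMultiScaleLamBond (iterBlockOf_congr_of_le)
open Summit.QuantumFields.YangMills.BalabanUVNodes.N12DirectSurjHsurjProxiesPrelim (fderiv_apply_eq_of_component_eq)

section
variable {F : T4Family} {N : ℕ} [NeZero N] {K k : ℕ}

/-- ★★ **DIFFERENTIABILITY OF THE CHART AT `U₀` FROM ONE GUARDED PROXY PER CONSTRAINED BOND** (dag-n12-c g21's `hprox` shape): every component of `Ψ_{𝐁,W,U₀}` is the corresponding component of
the chart at a guarded proxy in its own fibre (`msChart_apply_eq_of_eqOn_feeds_of_fibre`), hence smooth at `0` (`differentiableAt_msChartB`); a map into a finite product with differentiable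
components is differentiable. [cite: Balaban1988Convergent, (2.11) p.256; Balaban1987RG1, (0.4) p.253; Balaban1985Variational, (82)–(83) p.290] -/
theorem differentiableAt_msChart_of_towerProxies (hk : k ≤ (F.P K).m + (F.P K).K) {𝔅 : BDetSet (F.P K)} {W : MSField (F.P K) (SU N)} {U₀ : GaugeField (F.P K) 0 (SU N)}
    (hU : AgreeOnB 𝔅 (avgFamily (avOfRecord F N K) U₀) W)
    (hprox : ∀ i : Fin (constrCardB 𝔅 k), ∃ U' : GaugeField (F.P K) 0 (SU N),
      (∀ b ∈ feeds (((constrEnumB 𝔅 k).symm i).1 : ℕ) ((constrEnumB 𝔅 k).symm i).2.1, U' b = U₀ b) ∧ SmallBelow (avOfRecord F N K) k U') :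
    DifferentiableAt ℝ (msChartB F N K k 𝔅 W U₀) 0 := by
  refine differentiableAt_pi.2 fun i => ?_
  obtain ⟨U', hin, hsb'⟩ := hprox i
  have hfun : (fun X => msChartB F N K k 𝔅 W U₀ X i) = fun X => msChartB F N K k 𝔅 (avgFamily (avOfRecord F N K) U') U' X i :=
    funext fun X => msChart_apply_eq_of_eqOn_feeds_of_fibre hk hU i hin X
  rw [hfun]
  exact differentiableAt_pi.1 (differentiableAt_msChartB (K := K) (k := k) (𝔅 := 𝔅) (W := avgFamily (avOfRecord F N K) U') (U := U') (fun _ _ _ => rfl) hsb') i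

end

section
variable {F : T4Family} {N : ℕ} [NeZero N] {K k : ℕ}

/-- ★★ **THE `i`-TH DERIVATIVE COMPONENT AT `U₀` IS THE ONE AT A PROXY AGREEING ON THE SHARP TOWER** (`U₀` in the fibre of `W` with `Ψ_{𝐁,W,U₀}` differentiable at `0`, the proxy `U′` guarded):
`(DΨ_{𝐁,W,U₀}(0)w)_i = (DΨ_{𝐁,M˙U′,U′}(0)w)_i`. [cite: Balaban1988Convergent, (2.10)–(2.11) p.256; Balaban1987RG1, (0.4) p.253; Balaban1985Variational, (47) p.285, (82)–(83) p.290] -/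
theorem fderiv_msChart_apply_eq_of_sharpProxy (hk : k ≤ (F.P K).m + (F.P K).K) {𝔅 : BDetSet (F.P K)} {W : MSField (F.P K) (SU N)}
    {U₀ U' : GaugeField (F.P K) 0 (SU N)} (hU : AgreeOnB 𝔅 (avgFamily (avOfRecord F N K) U₀) W) (hΨ : DifferentiableAt ℝ (msChartB F N K k 𝔅 W U₀) 0)
    (hsb' : SmallBelow (avOfRecord F N K) k U') (i : Fin (constrCardB 𝔅 k))
    (hin : ∀ b₀ : PBond (F.P K) 0,
      (iterBlockOf (((constrEnumB 𝔅 k).symm i).1 : ℕ) b₀.src = ((constrEnumB 𝔅 k).symm i).2.1.src ∨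
        iterBlockOf (((constrEnumB 𝔅 k).symm i).1 : ℕ) b₀.src = ((constrEnumB 𝔅 k).symm i).2.1.tgt) →
      (iterBlockOf (((constrEnumB 𝔅 k).symm i).1 : ℕ) b₀.tgt = ((constrEnumB 𝔅 k).symm i).2.1.src ∨
        iterBlockOf (((constrEnumB 𝔅 k).symm i).1 : ℕ) b₀.tgt = ((constrEnumB 𝔅 k).symm i).2.1.tgt) → U' b₀ = U₀ b₀)
    (w : PBond (F.P K) 0 → lieSU (Fin N)) :
    fderiv ℝ (msChartB F N K k 𝔅 W U₀) 0 w i = fderiv ℝ (msChartB F N K k 𝔅 (avgFamily (avOfRecord F N K) U') U') 0 w i :=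
  fderiv_apply_eq_of_component_eq hΨ (differentiableAt_msChartB (K := K) (k := k) (𝔅 := 𝔅) (W := avgFamily (avOfRecord F N K) U') (U := U') (fun _ _ _ => rfl) hsb') i
    (fun X => msChart_apply_eq_of_eqOn_sharp_of_fibre hk hU i hin X) w

end

section
variable {F : T4Family} {N : ℕ} [NeZero N] {K k : ℕ}

/-- ★ g6's `…Footprint.fderiv_msChart_apply_eq_zero_of_vanish_sharp` with the guard replaced by DIFFERENTIABILITY of `Ψ_{𝐁,W,U₀}` at `0`: a direction vanishing on the sharp tower of a row
does not move it. [cite: Balaban1987RG1, (0.4) p.253; Balaban1988Convergent, (2.10)–(2.11) p.256; Balaban1985Variational, (82)–(83) p.290] -/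
theorem fderiv_msChart_apply_eq_zero_of_vanish_sharp' (hk : k ≤ (F.P K).m + (F.P K).K) {𝔅 : BDetSet (F.P K)} {W : MSField (F.P K) (SU N)}
    {U₀ : GaugeField (F.P K) 0 (SU N)} (hΨ : DifferentiableAt ℝ (msChartB F N K k 𝔅 W U₀) 0)
    (X : PBond (F.P K) 0 → lieSU (Fin N)) (i : Fin (constrCardB 𝔅 k))
    (hX : ∀ b₀ : PBond (F.P K) 0,
      (iterBlockOf (((constrEnumB 𝔅 k).symm i).1 : ℕ) b₀.src = ((constrEnumB 𝔅 k).symm i).2.1.src ∨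
        iterBlockOf (((constrEnumB 𝔅 k).symm i).1 : ℕ) b₀.src = ((constrEnumB 𝔅 k).symm i).2.1.tgt) →
      (iterBlockOf (((constrEnumB 𝔅 k).symm i).1 : ℕ) b₀.tgt = ((constrEnumB 𝔅 k).symm i).2.1.src ∨
        iterBlockOf (((constrEnumB 𝔅 k).symm i).1 : ℕ) b₀.tgt = ((constrEnumB 𝔅 k).symm i).2.1.tgt) → X b₀ = 0) :
    fderiv ℝ (msChartB F N K k 𝔅 W U₀) 0 X i = 0 := by
  have hj : (((constrEnumB 𝔅 k).symm i).1 : ℕ) ≤ (F.P K).m + (F.P K).K := (Nat.le_of_lt_succ ((constrEnumB 𝔅 k).symm i).1.2).trans hk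
  have hconst : ∀ t : ℝ, msChartB F N K k 𝔅 W U₀ (t • X) i = msChartB F N K k 𝔅 W U₀ 0 i := by
    intro t
    have havg : avgFamily (avOfRecord F N K) (expChart U₀ (t • X)) _ ((constrEnumB 𝔅 k).symm i).2.1
        = avgFamily (avOfRecord F N K) U₀ _ ((constrEnumB 𝔅 k).symm i).2.1 :=
      iter_congr_of_twoBlockLocal (avOfRecord F N K) (fun _ => twoBlockLocal_blockAvg _) _ hj _ _ _ fun b₀ hs ht => by
        show U₀ b₀ * expSU ((t • X) b₀) = U₀ b₀
        rw [Pi.smul_apply, hX b₀ hs ht, smul_zero, Node00.expSU_zero, mul_one]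
    rw [msChartB_apply, msChartB_apply, relAvg, relAvg, expChart_zero, havg]
  have hray : HasDerivAt (fun t : ℝ => msChartB F N K k 𝔅 W U₀ (t • X) i) (fderiv ℝ (msChartB F N K k 𝔅 W U₀) 0 X i) 0 := by
    have h := hΨ.hasFDerivAt.comp_hasDerivAt_of_eq (0 : ℝ) (hasDerivAt_ray X) (zero_smul ℝ X).symm
    exact (hasDerivAt_pi.1 h) i
  have hzero : HasDerivAt (fun t : ℝ => msChartB F N K k 𝔅 W U₀ (t • X) i) 0 0 := by
    have : (fun t : ℝ => msChartB F N K k 𝔅 W U₀ (t • X) i) = fun _ => msChartB F N K k 𝔅 W U₀ 0 i := funext hconst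
    rw [this]
    exact hasDerivAt_const _ _
  exact hray.unique hzero

end

section
variable {F : T4Family} {N : ℕ} [NeZero N] {K k : ℕ}

/-- ★★ g6's `…Footprint.fderiv_msChart_apply_eq_zero_of_siteSupport` — THE EXACT FOOTPRINT OF A SITE COLUMN — with the guard replaced by DIFFERENTIABILITY of `Ψ` at `0`: for an inner
`(n+1)`-site `y′` and a direction supported on bonds inside `B^{n+1}(y′)` crossing an internal `n`-face, `(DΨ(0)X)_i = 0` at every row of level `≤ n` and at every level-`(n+1)` row not touching `y′`.
[cite: Balaban1987RG1, (0.4) p.253; Balaban1988Convergent, (2.2) p.255, (2.10)–(2.13) pp.256–257; Balaban1985Variational, (82)–(83) p.290] -/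
theorem fderiv_msChart_apply_eq_zero_of_siteSupport' {M₁ : ℕ} (hM : 1 ≤ M₁) {Z : Set (Site (F.P K) 0)} (hdiv : side (F.P K).L M₁ k ∣ (F.P K).sitesPerDir 0)
    (hk : k ≤ (F.P K).m + (F.P K).K) {W : MSField (F.P K) (SU N)} {U₀ : GaugeField (F.P K) 0 (SU N)}
    (hΨ : DifferentiableAt ℝ (msChartB F N K k (lamBondsSeq (maxDomT M₁ Z) k) W U₀) 0)
    {n : ℕ} (hn : n + 1 ≤ k) {y' : Site (F.P K) (n + 1)} (hy' : embIter (n + 1) y' ∈ maxDomT M₁ Z (n + 1))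
    (X : PBond (F.P K) 0 → lieSU (Fin N))
    (hX : ∀ b : PBond (F.P K) 0, X b ≠ 0 → iterBlockOf (n + 1) b.src = y' ∧ iterBlockOf (n + 1) b.tgt = y' ∧ iterBlockOf n b.src ≠ iterBlockOf n b.tgt)
    (i : Fin (constrCardB (lamBondsSeq (maxDomT M₁ Z) k) k))
    (hi : (((constrEnumB (lamBondsSeq (maxDomT M₁ Z) k) k).symm i).1 : ℕ) ≤ n ∨
      ((((constrEnumB (lamBondsSeq (maxDomT M₁ Z) k) k).symm i).1 : ℕ) = n + 1 ∧
        embIter _ ((constrEnumB (lamBondsSeq (maxDomT M₁ Z) k) k).symm i).2.1.src ≠ embIter (n + 1) y' ∧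
        embIter _ ((constrEnumB (lamBondsSeq (maxDomT M₁ Z) k) k).symm i).2.1.tgt ≠ embIter (n + 1) y')) :
    fderiv ℝ (msChartB F N K k (lamBondsSeq (maxDomT M₁ Z) k) W U₀) 0 X i = 0 := by
  set s := (constrEnumB (lamBondsSeq (maxDomT M₁ Z) k) k).symm i with hs
  refine fderiv_msChart_apply_eq_zero_of_vanish_sharp' hk hΨ X i fun b₀ hbs hbt => ?_
  by_contra hb
  obtain ⟨hys, hyt, hne⟩ := hX b₀ hb
  have hj'K : ((s.1 : ℕ)) ≤ (F.P K).m + (F.P K).K := (Nat.le_of_lt_succ s.1.2).trans hk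
  rcases hi with hle | ⟨heq, hns, hnt⟩
  · -- level `≤ n`: both end-points of the row have their centres in `B^{n+1}(y′)`, so the row is unconstrained — contradiction
    have hne' : iterBlockOf (s.1 : ℕ) b₀.src ≠ iterBlockOf (s.1 : ℕ) b₀.tgt := fun h => hne (iterBlockOf_congr_of_le hle h)
    -- the two end-points of `s.2.1` are the two `s.1`-blocks of `b₀`
    have hends : ∀ w : Site (F.P K) s.1, (w = s.2.1.src ∨ w = s.2.1.tgt) →
        (w = iterBlockOf (s.1 : ℕ) b₀.src ∨ w = iterBlockOf (s.1 : ℕ) b₀.tgt) := by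
      intro w hw
      rcases hbs with h1 | h1 <;> rcases hbt with h2 | h2
      · exact absurd (h1.trans h2.symm) hne'
      · rcases hw with rfl | rfl
        · exact Or.inl h1.symm
        · exact Or.inr h2.symm
      · rcases hw with rfl | rfl
        · exact Or.inr h2.symm
        · exact Or.inl h1.symm
      · exact absurd (h1.trans h2.symm) hne'
    have hcentre : ∀ w : Site (F.P K) s.1, (w = s.2.1.src ∨ w = s.2.1.tgt) → iterBlockOf (n + 1) (embIter (s.1 : ℕ) w) = y' := by
      intro w hw
      rcases hends w hw with rfl | rfl
      · rw [iterBlockOf_embIter_iterBlockOf (by omega) hj'K]; exact hys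
      · rw [iterBlockOf_embIter_iterBlockOf (by omega) hj'K]; exact hyt
    exact not_mem_bondsOf_Bj_of_centres hM hdiv hk hn hy' hle s.2.1 (hcentre _ (Or.inl rfl)) (hcentre _ (Or.inr rfl)) (lamBondsSeq_subset_bondsOf_genSet _ _ _ s.2.2)
  · -- level `n + 1`, row not touching `y′`: but `y′` is the `(n+1)`-block of `b₀₋`
    have key : ∀ w : Site (F.P K) s.1, iterBlockOf (s.1 : ℕ) b₀.src = w → embIter (s.1 : ℕ) w = embIter (n + 1) y' := by
      intro w hw
      have h1 : iterBlockOf (n + 1) (embIter (s.1 : ℕ) w) = iterBlockOf (n + 1) b₀.src := by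
        rw [← hw]; exact iterBlockOf_embIter_iterBlockOf (le_of_eq heq) hj'K b₀.src
      rw [hys] at h1
      -- `s.1 = n+1`: the centre of an `(n+1)`-block determines it
      have h2 : iterBlockOf (n + 1) (embIter (n + 1) y') = y' := iterBlockOf_embIter (n + 1) (hn.trans hk) y'
      have h3 : iterBlockOf (s.1 : ℕ) (embIter (s.1 : ℕ) w) = w := iterBlockOf_embIter _ hj'K w
      -- transport along `heq`
      have h4 : ∀ (m : ℕ) (hm : m = n + 1) (x : Site (F.P K) 0) (w' : Site (F.P K) m),
          iterBlockOf m x = w' → iterBlockOf (n + 1) x = y' → embIter m w' = embIter (n + 1) y' := by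
        intro m hm x w' hx hy
        subst hm
        rw [← hx, hy]
      exact h4 _ heq (embIter (s.1 : ℕ) w) w h3 h1
    rcases hbs with h1 | h1
    · exact hns (key _ h1)
    · exact hnt (key _ h1)

end

end Summit.QuantumFields.YangMills.BalabanUVNodes.N12DirectSurjHsurjProxiesPrelimB

end
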